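import Literature.NumberTheory.LFunctions.SiegelAbelSummation
import HarnessLib

/-!
# Partial sums of `∑ χ(n) n^{-σ}` against `L(σ, χ)` on the real axis; real characters as real
# arithmetic functions

Topic `Literature/NumberTheory/LFunctions`, a companion of `SiegelAbelSummation.lean` (Abel
summation `L(s, χ) = ∑_{n ≥ 1} S(n)(n^{-s} − (n+1)^{-s})` on `Re s > 0`,
`Literature.NumberTheory.LFunctions.DirichletAbel.LFunction_eq_abelSum`). Everything here is
PROVED (theorems only) and elementary:

* `DirichletAbel.LFunction_sub_sum_eq` — the tail formula
  `L(s, χ) − ∑_{n ≤ N} χ(n) n^{-s} = ∑_{n > N} S(n)(n^{-s} − (n+1)^{-s}) − S(N)(N+1)^{-s}`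
  (`Re s > 0`, `χ ≠ χ₀`);
* `DirichletAbel.norm_LFunction_sub_sum_le` — **on the real axis the tail telescopes**: for real
  `σ > 0` and `χ ≠ χ₀` mod `q`,
  `|L(σ, χ) − ∑_{n ≤ N} χ(n) n^{-σ}| ≤ 2 q (N+1)^{-σ}` (Montgomery–Vaughan, *Multiplicative Number
  Theory I*, §4.3: `|S(n)| ≤ q`, (4.23), with the partial summation of Thm. 1.3);
* `DirichletAbel.reChar χ` — a quadratic (`χ² = 1`) Dirichlet character as a real-valued,
  multiplicative arithmetic function `n ↦ Re χ(n)` (values in `{0, ±1}`), with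
  `((reChar χ n : ℝ) : ℂ) = χ(n)`;
* `DirichletAbel.LFunction_ofReal_eq_re` — `L(σ, χ) = Re L(σ, χ)` for real `σ > 0`, quadratic
  `χ ≠ χ₀`;
* `DirichletAbel.abs_re_LFunction_sub_sum_le`, `…_floor_le` — the real form of the tail bound:
  `|Re L(σ, χ) − ∑_{1 ≤ n ≤ N} Re χ(n) · n^{-σ}| ≤ 2q (N+1)^{-σ}`, and with `N = ⌊t⌋`,
  `≤ 2q t^{-σ}` for every real `t > 0`.

These are the inputs "`∑_{n ≤ x} χ(n) n^{-s} = L(s, χ) + O(q x^{-σ})`" of the elementary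
treatment of `L(1, χ)` and of `∑_{n ≤ x} (1 ∗ χ)(n)` for real characters (Davenport,
*Multiplicative Number Theory*, Ch. 4 and Ch. 6, (2)–(4); Montgomery–Vaughan §4.3, p. 100).

## References

* H. L. Montgomery, R. C. Vaughan, *Multiplicative Number Theory I. Classical Theory*, Cambridge
  (2007), §1.3 Thm. 1.3, §4.3 (4.20)–(4.23), Thm. 4.8. [MontgomeryVaughan2007]

## Design notes

* Sums are indexed as in `SiegelAbelSummation.lean` (`∑_{n < N} χ(n+1)(n+1)^{-s}`) for the complex
  statements, and over `Finset.Ioc 0 N` (`1 ≤ n ≤ N`, the indexing of Mathlib's hyperbola lemmas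
  `ArithmeticFunction.sum_Ioc_mul_eq_sum_sum`) for the real ones; `sum_Ioc_eq_sum_range_succ`
  converts.
* `reChar χ` is `toArithmeticFunction (n ↦ Re χ(n))`, so `reChar χ 0 = 0` by definition (also when
  `q = 1`); all evaluation lemmas assume `n ≠ 0` or quantify over `1 ≤ n`.
-/

noncomputable section

open Complex Filter Topology Finset ArithmeticFunction

namespace Literature.NumberTheory.LFunctions.DirichletAbel

variable {q : ℕ} [NeZero q] (χ : DirichletCharacter ℂ q)

/-! ### The tail of the Abel transform -/

/-- **Tail formula**: for `χ ≠ χ₀` and `Re s > 0`,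
`L(s, χ) − ∑_{n < N} χ(n+1)(n+1)^{-s} = ∑_{n ≥ 0} S(n+N+1)((n+N+1)^{-s} − (n+N+2)^{-s}) − S(N)(N+1)^{-s}`
(`LFunction_eq_abelSum` and the finite Abel summation `sum_apply_mul_cpow_eq`).
[cite: MontgomeryVaughan2007, §1.3 Thm. 1.3 and §4.3 Thm. 4.8] -/
theorem LFunction_sub_sum_eq (hχ : χ ≠ 1) {s : ℂ} (hs : 0 < s.re) (N : ℕ) :
    χ.LFunction s - ∑ n ∈ range N, χ ((n + 1 : ℕ) : ZMod q) * ((n + 1 : ℕ) : ℂ) ^ (-s) =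
      ∑' n : ℕ, term χ (n + N) s - partialSum χ N * ((N + 1 : ℕ) : ℂ) ^ (-s) := by
  rw [LFunction_eq_abelSum χ hχ hs, abelSum, sum_apply_mul_cpow_eq,
    ← (summable_term χ hχ hs).sum_add_tsum_nat_add N]
  ring

omit [NeZero q] in
/-- The power `(n+1)^{-σ}` at a real exponent is the real power, cast to `ℂ`. [folklore] -/
theorem natCast_cpow_neg_ofReal (n : ℕ) (σ : ℝ) :
    ((n + 1 : ℕ) : ℂ) ^ (-(σ : ℂ)) = ((((n + 1 : ℕ) : ℝ) ^ (-σ) : ℝ) : ℂ) := by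
  rw [show ((n + 1 : ℕ) : ℂ) = (((n + 1 : ℕ) : ℝ) : ℂ) by push_cast; rfl, ← ofReal_neg,
    ← ofReal_cpow (by positivity)]

/-- At a real point `σ > 0` the Abel term is bounded by a telescoping difference:
`‖S(n+1)((n+1)^{-σ} − (n+2)^{-σ})‖ ≤ q ((n+1)^{-σ} − (n+2)^{-σ})` for `χ ≠ χ₀`. [folklore] -/
theorem norm_term_ofReal_le (hχ : χ ≠ 1) (n : ℕ) {σ : ℝ} (hσ : 0 < σ) :
    ‖term χ n σ‖ ≤ q * ((((n + 1 : ℕ) : ℝ)) ^ (-σ) - (((n + 1 + 1 : ℕ) : ℝ)) ^ (-σ)) := by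
  unfold term
  rw [norm_mul, natCast_cpow_neg_ofReal, natCast_cpow_neg_ofReal, ← ofReal_sub, norm_real,
    Real.norm_eq_abs]
  have hmono : (((n + 1 + 1 : ℕ) : ℝ)) ^ (-σ) ≤ (((n + 1 : ℕ) : ℝ)) ^ (-σ) := by
    apply Real.rpow_le_rpow_of_nonpos (by positivity) (by push_cast; linarith) (by linarith)
  rw [abs_of_nonneg (sub_nonneg.mpr hmono)]
  exact mul_le_mul_of_nonneg_right (norm_partialSum_le χ hχ (n + 1)) (sub_nonneg.mpr hmono)

/-- **The tail telescopes on the real axis**: for `χ ≠ χ₀`, real `σ > 0` and every `N`,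
`‖∑_{n ≥ 0} S(n+N+1)((n+N+1)^{-σ} − (n+N+2)^{-σ})‖ ≤ q (N+1)^{-σ}`. [folklore] -/
theorem norm_tsum_term_add_le (hχ : χ ≠ 1) {σ : ℝ} (hσ : 0 < σ) (N : ℕ) :
    ‖∑' n : ℕ, term χ (n + N) σ‖ ≤ q * ((N + 1 : ℕ) : ℝ) ^ (-σ) := by
  have hs : 0 < (σ : ℂ).re := by simpa using hσ
  have hsum : Summable fun n => term χ (n + N) (σ : ℂ) :=
    (summable_term χ hχ hs).comp_injective (add_left_injective N)
  -- the telescoping sequence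
  set a : ℕ → ℝ := fun m => (((m + N + 1 : ℕ) : ℝ)) ^ (-σ) with ha
  have hterm : ∀ n, ‖term χ (n + N) σ‖ ≤ q * (a n - a (n + 1)) := by
    intro n
    have h := norm_term_ofReal_le χ hχ (n + N) hσ
    have e1 : ((n + N + 1 + 1 : ℕ) : ℝ) = ((n + 1 + N + 1 : ℕ) : ℝ) := by push_cast; ring
    simpa only [ha, e1] using h
  have hanonneg : ∀ m, 0 ≤ a m := fun m => by positivity
  have hpart : ∀ M, ∑ n ∈ range M, ‖term χ (n + N) σ‖ ≤ q * ((N + 1 : ℕ) : ℝ) ^ (-σ) := by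
    intro M
    calc ∑ n ∈ range M, ‖term χ (n + N) σ‖ ≤ ∑ n ∈ range M, q * (a n - a (n + 1)) :=
          sum_le_sum fun n _ => hterm n
      _ = q * (a 0 - a M) := by rw [← mul_sum, sum_range_sub']
      _ ≤ q * a 0 := by
          have := hanonneg M
          gcongr
          linarith
      _ = q * ((N + 1 : ℕ) : ℝ) ^ (-σ) := by simp [ha]
  calc ‖∑' n : ℕ, term χ (n + N) σ‖ ≤ ∑' n : ℕ, ‖term χ (n + N) σ‖ := norm_tsum_le_tsum_norm hsum.norm
    _ ≤ q * ((N + 1 : ℕ) : ℝ) ^ (-σ) := Real.tsum_le_of_sum_range_le (fun n => norm_nonneg _) hpart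

/-- **Partial sums on the real axis** (MV §4.3, p. 100 with Thm. 1.3): for `χ ≠ χ₀` mod `q`, real
`σ > 0` and every `N ≥ 0`,
`‖L(σ, χ) − ∑_{n=1}^{N} χ(n) n^{-σ}‖ ≤ 2 q (N+1)^{-σ}`.
[cite: MontgomeryVaughan2007, §4.3 (4.23) and Thm. 4.8] -/
theorem norm_LFunction_sub_sum_le (hχ : χ ≠ 1) {σ : ℝ} (hσ : 0 < σ) (N : ℕ) :
    ‖χ.LFunction σ - ∑ n ∈ range N, χ ((n + 1 : ℕ) : ZMod q) * ((n + 1 : ℕ) : ℂ) ^ (-(σ : ℂ))‖ ≤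
      2 * q * ((N + 1 : ℕ) : ℝ) ^ (-σ) := by
  have hs : 0 < (σ : ℂ).re := by simpa using hσ
  rw [LFunction_sub_sum_eq χ hχ hs N]
  have hB : ‖partialSum χ N * ((N + 1 : ℕ) : ℂ) ^ (-(σ : ℂ))‖ ≤ q * ((N + 1 : ℕ) : ℝ) ^ (-σ) := by
    rw [norm_mul, norm_natCast_cpow_of_pos (Nat.succ_pos N), neg_re, ofReal_re]
    exact mul_le_mul_of_nonneg_right (norm_partialSum_le χ hχ N) (by positivity)
  calc ‖∑' n : ℕ, term χ (n + N) σ - partialSum χ N * ((N + 1 : ℕ) : ℂ) ^ (-(σ : ℂ))‖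
      ≤ ‖∑' n : ℕ, term χ (n + N) σ‖ + ‖partialSum χ N * ((N + 1 : ℕ) : ℂ) ^ (-(σ : ℂ))‖ :=
        norm_sub_le _ _
    _ ≤ q * ((N + 1 : ℕ) : ℝ) ^ (-σ) + q * ((N + 1 : ℕ) : ℝ) ^ (-σ) :=
        add_le_add (norm_tsum_term_add_le χ hχ hσ N) hB
    _ = 2 * q * ((N + 1 : ℕ) : ℝ) ^ (-σ) := by ring

/-! ### Quadratic characters as real arithmetic functions -/

/-- A Dirichlet character with real values, as a real arithmetic function: `reChar χ n = Re χ(n)`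
for `n ≥ 1` (and `0` at `n = 0`). For quadratic `χ` (`χ² = 1`) these are the values of `χ`
themselves (`ofReal_reChar`). [folklore] -/
def reChar : ArithmeticFunction ℝ :=
  toArithmeticFunction fun n : ℕ => (χ (n : ZMod q)).re

omit [NeZero q] in
/-- Evaluation: `reChar χ n = Re χ(n)` for `n ≠ 0`. [folklore] -/
theorem reChar_apply {n : ℕ} (hn : n ≠ 0) : reChar χ n = (χ (n : ZMod q)).re := by
  simp [reChar, toArithmeticFunction, hn]

omit [NeZero q] in
/-- `reChar χ 0 = 0`. [folklore] -/
@[simp] theorem reChar_zero : reChar χ 0 = 0 := by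
  simp [reChar, toArithmeticFunction]

omit [NeZero q] in
/-- A quadratic character is real: `χ(a) = Re χ(a)` as complex numbers. [folklore] -/
theorem apply_eq_ofReal_re (hq : χ ^ 2 = 1) (a : ZMod q) : χ a = ((χ a).re : ℂ) :=
  Complex.ext (by simp) (by simp [apply_im_eq_zero χ hq a])

omit [NeZero q] in
/-- For quadratic `χ` and `n ≥ 1`: `((reChar χ n : ℝ) : ℂ) = χ(n)`. [folklore] -/
theorem ofReal_reChar (hq : χ ^ 2 = 1) {n : ℕ} (hn : n ≠ 0) :
    ((reChar χ n : ℝ) : ℂ) = χ (n : ZMod q) := by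
  rw [reChar_apply χ hn, ← apply_eq_ofReal_re χ hq]

omit [NeZero q] in
/-- The values of `reChar χ` for quadratic `χ` are `0`, `1` or `-1`. [folklore] -/
theorem reChar_trichotomy (hq : χ ^ 2 = 1) (n : ℕ) :
    reChar χ n = 0 ∨ reChar χ n = 1 ∨ reChar χ n = -1 := by
  rcases eq_or_ne n 0 with rfl | hn
  · exact Or.inl (reChar_zero χ)
  rw [reChar_apply χ hn]
  rcases MulChar.isQuadratic_iff_sq_eq_one.mpr hq (n : ZMod q) with h | h | h <;> simp [h]

omit [NeZero q] in
/-- `|reChar χ n| ≤ 1`. [folklore] -/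
theorem abs_reChar_le_one (n : ℕ) : |reChar χ n| ≤ 1 := by
  rcases eq_or_ne n 0 with rfl | hn
  · simp
  rw [reChar_apply χ hn]
  exact (Complex.abs_re_le_norm _).trans (χ.norm_le_one _)

omit [NeZero q] in
/-- `reChar χ` is (completely) multiplicative: `reChar χ (m n) = reChar χ m · reChar χ n` for
`m, n ≥ 1`, when `χ` is quadratic. [folklore] -/
theorem reChar_mul (hq : χ ^ 2 = 1) {m n : ℕ} (hm : m ≠ 0) (hn : n ≠ 0) :
    reChar χ (m * n) = reChar χ m * reChar χ n := by
  apply Complex.ofReal_injective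
  rw [ofReal_mul, ofReal_reChar χ hq (mul_ne_zero hm hn), ofReal_reChar χ hq hm,
    ofReal_reChar χ hq hn, Nat.cast_mul, map_mul χ]

omit [NeZero q] in
/-- `reChar χ 1 = 1`. [folklore] -/
@[simp] theorem reChar_one : reChar χ 1 = 1 := by
  rw [reChar_apply χ one_ne_zero]; simp

omit [NeZero q] in
/-- `reChar χ` is a multiplicative arithmetic function (quadratic `χ`). [folklore] -/
theorem isMultiplicative_reChar (hq : χ ^ 2 = 1) : (reChar χ).IsMultiplicative :=
  ⟨reChar_one χ, fun {m n} hmn => by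
    rcases eq_or_ne m 0 with rfl | hm
    · simp
    rcases eq_or_ne n 0 with rfl | hn
    · simp
    exact reChar_mul χ hq hm hn⟩

/-! ### `L(σ, χ)` on the real axis: real values and real partial sums -/

/-- For quadratic `χ ≠ χ₀` and real `σ > 0`, `L(σ, χ)` is the real number `Re L(σ, χ)`.
[cite: MontgomeryVaughan2007, §4.3 p. 102] -/
theorem LFunction_ofReal_eq_re (hχ : χ ≠ 1) (hq : χ ^ 2 = 1) {σ : ℝ} (hσ : 0 < σ) :
    χ.LFunction σ = ((χ.LFunction σ).re : ℂ) :=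
  Complex.ext (by simp) (by simp [LFunction_ofReal_im_eq_zero χ hχ hq hσ])

omit [NeZero q] in
/-- Re-indexing `∑_{n < N} f(n+1) = ∑_{1 ≤ n ≤ N} f(n)` (`Finset.Ioc 0 N`). [folklore] -/
theorem sum_Ioc_eq_sum_range_succ {M : Type*} [AddCommMonoid M] (f : ℕ → M) (N : ℕ) :
    ∑ n ∈ Ioc 0 N, f n = ∑ n ∈ range N, f (n + 1) := by
  induction N with
  | zero => simp
  | succ N ih => rw [sum_range_succ, ← ih, sum_Ioc_succ_top (Nat.zero_le _)]

omit [NeZero q] in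
/-- The complex partial sum at a real point is the real partial sum of `reChar χ`:
`∑_{n < N} χ(n+1)(n+1)^{-σ} = ∑_{1 ≤ n ≤ N} reChar χ(n) n^{-σ}` (quadratic `χ`). [folklore] -/
theorem sum_apply_mul_cpow_ofReal (hq : χ ^ 2 = 1) (σ : ℝ) (N : ℕ) :
    ∑ n ∈ range N, χ ((n + 1 : ℕ) : ZMod q) * ((n + 1 : ℕ) : ℂ) ^ (-(σ : ℂ)) =
      ((∑ n ∈ Ioc 0 N, reChar χ n * (n : ℝ) ^ (-σ) : ℝ) : ℂ) := by
  rw [sum_Ioc_eq_sum_range_succ, ofReal_sum]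
  refine sum_congr rfl fun n _ => ?_
  rw [ofReal_mul, ofReal_reChar χ hq (Nat.succ_ne_zero n), natCast_cpow_neg_ofReal]

/-- **Real form of the tail bound**: for quadratic `χ ≠ χ₀` mod `q`, real `σ > 0` and `N ≥ 0`,
`|Re L(σ, χ) − ∑_{1 ≤ n ≤ N} reChar χ(n) n^{-σ}| ≤ 2q (N+1)^{-σ}`.
[cite: MontgomeryVaughan2007, §4.3 (4.23) and Thm. 4.8] -/
theorem abs_re_LFunction_sub_sum_le (hχ : χ ≠ 1) (hq : χ ^ 2 = 1) {σ : ℝ} (hσ : 0 < σ) (N : ℕ) :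
    |(χ.LFunction σ).re - ∑ n ∈ Ioc 0 N, reChar χ n * (n : ℝ) ^ (-σ)| ≤
      2 * q * ((N + 1 : ℕ) : ℝ) ^ (-σ) := by
  have h := norm_LFunction_sub_sum_le χ hχ hσ N
  rw [sum_apply_mul_cpow_ofReal χ hq, LFunction_ofReal_eq_re χ hχ hq hσ, ← ofReal_sub, norm_real,
    Real.norm_eq_abs] at h
  exact h

/-- The tail bound at `N = ⌊t⌋`: for quadratic `χ ≠ χ₀` mod `q`, real `σ > 0` and real `t > 0`,
`|Re L(σ, χ) − ∑_{1 ≤ n ≤ t} reChar χ(n) n^{-σ}| ≤ 2q t^{-σ}` (since `⌊t⌋ + 1 > t`).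
[cite: MontgomeryVaughan2007, §4.3 (4.23) and Thm. 4.8] -/
theorem abs_re_LFunction_sub_sum_floor_le (hχ : χ ≠ 1) (hq : χ ^ 2 = 1) {σ : ℝ} (hσ : 0 < σ)
    {t : ℝ} (ht : 0 < t) :
    |(χ.LFunction σ).re - ∑ n ∈ Ioc 0 ⌊t⌋₊, reChar χ n * (n : ℝ) ^ (-σ)| ≤ 2 * q * t ^ (-σ) := by
  refine (abs_re_LFunction_sub_sum_le χ hχ hq hσ ⌊t⌋₊).trans ?_
  have hlt : t ≤ ((⌊t⌋₊ + 1 : ℕ) : ℝ) := by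
    push_cast
    exact (Nat.lt_floor_add_one t).le
  have hq0 : (0 : ℝ) ≤ 2 * q := by positivity
  exact mul_le_mul_of_nonneg_left (Real.rpow_le_rpow_of_nonpos ht hlt (by linarith)) hq0

/-- The case `σ = 1`: `|L(1, χ) − ∑_{1 ≤ n ≤ t} reChar χ(n)/n| ≤ 2q/t` for quadratic `χ ≠ χ₀`
mod `q` and real `t > 0`. [cite: MontgomeryVaughan2007, §4.3 (4.23) and Thm. 4.8] -/
theorem abs_re_LFunction_one_sub_sum_floor_le (hχ : χ ≠ 1) (hq : χ ^ 2 = 1) {t : ℝ} (ht : 0 < t) :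
    |(χ.LFunction 1).re - ∑ n ∈ Ioc 0 ⌊t⌋₊, reChar χ n / n| ≤ 2 * q / t := by
  have h := abs_re_LFunction_sub_sum_floor_le χ hχ hq one_pos ht
  rw [ofReal_one, Real.rpow_neg_one] at h
  have hsum : ∑ n ∈ Ioc 0 ⌊t⌋₊, reChar χ n * (n : ℝ) ^ (-(1 : ℝ)) =
      ∑ n ∈ Ioc 0 ⌊t⌋₊, reChar χ n / n :=
    sum_congr rfl fun n _ => by rw [Real.rpow_neg_one, div_eq_mul_inv]
  rw [hsum] at h
  simpa [div_eq_mul_inv] using h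

end Literature.NumberTheory.LFunctions.DirichletAbel
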